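/-
Copyright: the b2b-balaban T⁴-continuum CRUX team, row NE7b, leaf lineage `t4-ne7b-formalise-leaf-02` (gen 131). Project licence.
-/
import Summits.QuantumFields.BalabanUV.T4Continuum.Spine.NE7b.PlaquetteCubicLattice
import Summits.QuantumFields.BalabanUV.T4Continuum.Spine.NE7b.TorusPlaquetteIncidence

/-!
# THE JUNCTION ON THE PERIODIC LATTICE: `…PlaquetteCubicLattice`'s END with `ν = 2(d−1)` from `…TorusPlaquetteIncidence` — the convexity
# letter for `⟪x, A x⟫ + Σ_p g_p·P₃(x ∘ ι_p)` over the plaquettes of `(ℤ∕L)^d` on T-61's per-bond window has modulus `2σ − 12(d−1)·γ·a`,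
# i.e. `2σ − 36·γ·a` at `d = 4`: the desk's «36 = 6 × 6» (ρ-ne7bref-g75-1) as ONE kernel theorem with `σ, γ, a` the only letters
# (row NE7b, node U5c; letter (ℓ1) of the windowed road for the leading anharmonic term at the flat background)

Cell `pub-balaban`, sub-cell `t4`, spine estimate NE7b (`T4WeightBudget.RelWeightBound`; the cell's OWN estimate — NOT PRINTED in
[Bałaban 1983–89], NOT PROVED).  Crux-route work under `Spine/NE7b/` by the row's E-side ∕ key-readings ∕ lattice-geometry leaf lineage; NOTHING
of Bałaban's is named or asserted; no `T4Continuum/Support` leaf typed; no `def`, no notation; zero `sorry`.  Imports: this lineage's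
`…PlaquetteCubicLattice` (the END with `ν` displayed) and `…TorusPlaquetteIncidence` (`ν = 2(d−1)`, four distinct bonds per plaquette).

WHAT IS PROVED ([folklore]; sites `x : Fin d → ZMod L`, bonds `(x, μ)`, plaquettes `(x, μ < ν)` with edges
`(x, μ), (x + e_μ, ν), (x + e_ν, μ), (x, ν)` (hypothesis `hι`, inhabited in `…TorusPlaquetteIncidence`); chart `e : Fin n ≃ (bonds) × Fin 3`, block
reader `β` ∕ block projections `Q` characterised coordinatewise (`hβ`, `hQ`; inhabited in `…PlaquetteCubicLattice` §4); `1 < L`, `0 < d`):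
* **`firstOrderOn_quadratic_add_torusSlotForms_blockWindow`**: for `A` symmetric `σ`-coercive, `W` a linear subspace, `a ≥ 0`, `|g_p| ≤ γ`, and
  `f_p` the slot forms of `g_p·P₃(x ∘ ι_p)`: on `K = W ∩ ⋂_b {‖Q_b y‖ ≤ a}`,
  `∀ x y ∈ K, V x + ⟪∇V x, y − x⟫ + (2σ − 6·(2(d−1))·γ·a)∕2·‖y − x‖² ≤ V y`, `V = ⟪·, A ·⟫ + Σ_p f_p(·,·,·)`.
* **`firstOrderOn_quadratic_add_torusCubic_four`** (`d = 4`, `f`-free, reader-free): the same for `V = ⟪·, A ·⟫ + Σ_p g_p·P₃(x ∘ ι_p)` written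
  out in the chart, with modulus **`2σ − 36·γ·a`**.

NOT HERE (honest): the quartic and higher Taylor terms and non-flat backgrounds; WHICH `σ`, `g_p`, `a`, `W`, `L` are Bałaban's at step `k` and in
which chart print's small-field window is a product of per-bond balls ((A3) ∕ (A1c); refuter v101 §3 (i)–(ii), F515; NC-NE7b-α UNRULED); the
identification of `g·P₃` with the Wilson action's cubic term (T-71 ∕ F463 (i), READ); anything of Bałaban's.  BY-NAME EFFECT ON THE WALL: NONE.
NE7b NOT PRINTED ∕ NOT PROVED; spine PROVED 0∕9; rung (B)+1 on a FINITE torus — NOT infinite volume, NOT the mass gap, NOT Clay.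
HONEST DEPENDENCY: continuum YM on T⁴ ⇐ BetaPertH ∧ nine spine estimates (0/9 proved); BetaPertH ⇐ (D1) ∧ (D4) ∧ CAP+tail.
-/

set_option autoImplicit false

noncomputable section

open Real InnerProductSpace Set Finset Equiv
open scoped RealInnerProductSpace Matrix Gradient

namespace Summit.QuantumFields.BalabanUV.T4Continuum.NE7b.PlaquetteCubicTorus

variable {n d L : ℕ}

/-- **THE END ON `(ℤ∕L)^d`, SLOT-FORM CURRENCY: MODULUS `2σ − 6·(2(d−1))·γ·a`** — `…PlaquetteCubicLattice.firstOrderOn_quadratic_add_latticeSlotForms_blockWindow`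
with `hι` from `…TorusPlaquetteIncidence.plaquetteBonds_injective` (`1 < L`) and `hν` from `…card_plaquettes_through_bond_le` (`ν = 2(d−1)`). [folklore] -/
theorem firstOrderOn_quadratic_add_torusSlotForms_blockWindow [NeZero L] [Fact (1 < L)] (hd : 0 < d)
    (e : Fin n ≃ ((Fin d → ZMod L) × Fin d) × Fin 3) (β : EuclideanSpace ℝ (Fin n) → (Fin d → ZMod L) × Fin d → Fin 3 → ℝ)
    (Q : (Fin d → ZMod L) × Fin d → EuclideanSpace ℝ (Fin n) →L[ℝ] EuclideanSpace ℝ (Fin n))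
    (hβ : ∀ v b i, β v b i = v (e.symm (b, i))) (hQ : ∀ b x j, Q b x j = if (e j).1 = b then x j else 0)
    (ι : (Fin d → ZMod L) × {a : Fin d × Fin d // a.1 < a.2} → Fin 4 → (Fin d → ZMod L) × Fin d)
    (hι : ∀ x a, ι (x, a) = ![(x, a.1.1), (x + Pi.single a.1.1 1, a.1.2), (x + Pi.single a.1.2 1, a.1.1), (x, a.1.2)])
    (f : (Fin d → ZMod L) × {a : Fin d × Fin d // a.1 < a.2} → ContinuousMultilinearMap ℝ (fun _ : Fin 3 => EuclideanSpace ℝ (Fin n)) ℝ)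
    (g : (Fin d → ZMod L) × {a : Fin d × Fin d // a.1 < a.2} → ℝ) {γ : ℝ} (hγ₀ : 0 ≤ γ) (hγ : ∀ p, |g p| ≤ γ)
    (hf : ∀ p m, f p m = g p * (β (m 0) (ι p 0) ⬝ᵥ β (m 1) (ι p 1) ⨯₃ β (m 2) (ι p 2) + β (m 0) (ι p 0) ⬝ᵥ β (m 1) (ι p 1) ⨯₃ β (m 2) (ι p 3)
      - β (m 0) (ι p 0) ⬝ᵥ β (m 1) (ι p 2) ⨯₃ β (m 2) (ι p 3) - β (m 0) (ι p 1) ⬝ᵥ β (m 1) (ι p 2) ⨯₃ β (m 2) (ι p 3)))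
    (A : EuclideanSpace ℝ (Fin n) →L[ℝ] EuclideanSpace ℝ (Fin n)) (W : Submodule ℝ (EuclideanSpace ℝ (Fin n))) {a σ : ℝ} (ha : 0 ≤ a)
    (hA : ∀ v w : EuclideanSpace ℝ (Fin n), ⟪A v, w⟫ = ⟪v, A w⟫) (hσ : ∀ v : EuclideanSpace ℝ (Fin n), σ * ‖v‖ ^ 2 ≤ ⟪v, A v⟫) :
    ∀ x ∈ (W : Set (EuclideanSpace ℝ (Fin n))) ∩ {y | ∀ b, ‖Q b y‖ ≤ a},
      ∀ y ∈ (W : Set (EuclideanSpace ℝ (Fin n))) ∩ {y | ∀ b, ‖Q b y‖ ≤ a},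
        (⟪x, A x⟫ + ∑ p, f p (fun _ => x)) + ⟪gradient (fun z : EuclideanSpace ℝ (Fin n) => ⟪z, A z⟫ + ∑ p, f p (fun _ => z)) x, y - x⟫ +
          (2 * σ - 6 * ((2 * (d - 1) : ℕ) : ℝ) * γ * a) / 2 * ‖y - x‖ ^ 2 ≤ ⟪y, A y⟫ + ∑ p, f p (fun _ => y) := by
  haveI : Nonempty ((Fin d → ZMod L) × Fin d) := ⟨(fun _ => 0, ⟨0, hd⟩)⟩
  exact PlaquetteCubicLattice.firstOrderOn_quadratic_add_latticeSlotForms_blockWindow e β Q ι hβ hQ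
    (TorusPlaquetteIncidence.plaquetteBonds_injective ι hι) f g hγ₀ hγ hf
    (TorusPlaquetteIncidence.card_plaquettes_through_bond_le ι hι) A W ha hA hσ

/-- **THE END ON `(ℤ∕L)⁴`, `f`-FREE AND READER-FREE: MODULUS `2σ − 36·γ·a`** for `⟪x, A x⟫ + Σ_p g_p·P₃(x ∘ ι_p)` over the plaquettes of the
four-dimensional periodic lattice, on the per-bond window `W ∩ ⋂_b {‖Q_b y‖ ≤ a}` — `…PlaquetteCubicLattice.firstOrderOn_quadratic_add_latticeCubic`
with `ν = 6` (`…TorusPlaquetteIncidence.card_plaquettes_through_bond_le_six`) and `6 · 6 = 36`.  Displayed: `σ, γ, a` ONLY. [folklore] -/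
theorem firstOrderOn_quadratic_add_torusCubic_four [NeZero L] [Fact (1 < L)]
    (e : Fin n ≃ ((Fin 4 → ZMod L) × Fin 4) × Fin 3)
    (Q : (Fin 4 → ZMod L) × Fin 4 → EuclideanSpace ℝ (Fin n) →L[ℝ] EuclideanSpace ℝ (Fin n))
    (hQ : ∀ b x j, Q b x j = if (e j).1 = b then x j else 0)
    (ι : (Fin 4 → ZMod L) × {a : Fin 4 × Fin 4 // a.1 < a.2} → Fin 4 → (Fin 4 → ZMod L) × Fin 4)
    (hι : ∀ x a, ι (x, a) = ![(x, a.1.1), (x + Pi.single a.1.1 1, a.1.2), (x + Pi.single a.1.2 1, a.1.1), (x, a.1.2)])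
    (g : (Fin 4 → ZMod L) × {a : Fin 4 × Fin 4 // a.1 < a.2} → ℝ) {γ : ℝ} (hγ₀ : 0 ≤ γ) (hγ : ∀ p, |g p| ≤ γ)
    (A : EuclideanSpace ℝ (Fin n) →L[ℝ] EuclideanSpace ℝ (Fin n)) (W : Submodule ℝ (EuclideanSpace ℝ (Fin n))) {a σ : ℝ} (ha : 0 ≤ a)
    (hA : ∀ v w : EuclideanSpace ℝ (Fin n), ⟪A v, w⟫ = ⟪v, A w⟫) (hσ : ∀ v : EuclideanSpace ℝ (Fin n), σ * ‖v‖ ^ 2 ≤ ⟪v, A v⟫) :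
    ∀ x ∈ (W : Set (EuclideanSpace ℝ (Fin n))) ∩ {y | ∀ b, ‖Q b y‖ ≤ a},
      ∀ y ∈ (W : Set (EuclideanSpace ℝ (Fin n))) ∩ {y | ∀ b, ‖Q b y‖ ≤ a},
        (⟪x, A x⟫ + ∑ p, g p * ((fun i : Fin 3 => x (e.symm (ι p 0, i))) ⬝ᵥ (fun i => x (e.symm (ι p 1, i))) ⨯₃ (fun i => x (e.symm (ι p 2, i)))
            + (fun i : Fin 3 => x (e.symm (ι p 0, i))) ⬝ᵥ (fun i => x (e.symm (ι p 1, i))) ⨯₃ (fun i => x (e.symm (ι p 3, i)))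
            - (fun i : Fin 3 => x (e.symm (ι p 0, i))) ⬝ᵥ (fun i => x (e.symm (ι p 2, i))) ⨯₃ (fun i => x (e.symm (ι p 3, i)))
            - (fun i : Fin 3 => x (e.symm (ι p 1, i))) ⬝ᵥ (fun i => x (e.symm (ι p 2, i))) ⨯₃ (fun i => x (e.symm (ι p 3, i)))))
        + ⟪gradient (fun z : EuclideanSpace ℝ (Fin n) => ⟪z, A z⟫
            + ∑ p, g p * ((fun i : Fin 3 => z (e.symm (ι p 0, i))) ⬝ᵥ (fun i => z (e.symm (ι p 1, i))) ⨯₃ (fun i => z (e.symm (ι p 2, i)))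
              + (fun i : Fin 3 => z (e.symm (ι p 0, i))) ⬝ᵥ (fun i => z (e.symm (ι p 1, i))) ⨯₃ (fun i => z (e.symm (ι p 3, i)))
              - (fun i : Fin 3 => z (e.symm (ι p 0, i))) ⬝ᵥ (fun i => z (e.symm (ι p 2, i))) ⨯₃ (fun i => z (e.symm (ι p 3, i)))
              - (fun i : Fin 3 => z (e.symm (ι p 1, i))) ⬝ᵥ (fun i => z (e.symm (ι p 2, i))) ⨯₃ (fun i => z (e.symm (ι p 3, i))))) x,
            y - x⟫
        + (2 * σ - 36 * γ * a) / 2 * ‖y - x‖ ^ 2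
        ≤ ⟪y, A y⟫ + ∑ p, g p * ((fun i : Fin 3 => y (e.symm (ι p 0, i))) ⬝ᵥ (fun i => y (e.symm (ι p 1, i))) ⨯₃ (fun i => y (e.symm (ι p 2, i)))
            + (fun i : Fin 3 => y (e.symm (ι p 0, i))) ⬝ᵥ (fun i => y (e.symm (ι p 1, i))) ⨯₃ (fun i => y (e.symm (ι p 3, i)))
            - (fun i : Fin 3 => y (e.symm (ι p 0, i))) ⬝ᵥ (fun i => y (e.symm (ι p 2, i))) ⨯₃ (fun i => y (e.symm (ι p 3, i)))
            - (fun i : Fin 3 => y (e.symm (ι p 1, i))) ⬝ᵥ (fun i => y (e.symm (ι p 2, i))) ⨯₃ (fun i => y (e.symm (ι p 3, i)))) := by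
  intro x hx y hy
  have h := PlaquetteCubicLattice.firstOrderOn_quadratic_add_latticeCubic e Q ι hQ
    (TorusPlaquetteIncidence.plaquetteBonds_injective ι hι) g hγ₀ hγ
    (TorusPlaquetteIncidence.card_plaquettes_through_bond_le_six ι hι) A W ha hA hσ x hx y hy
  have h36 : (2 * σ - 6 * ((6 : ℕ) : ℝ) * γ * a) = 2 * σ - 36 * γ * a := by push_cast; ring
  rw [h36] at h
  exact h

end Summit.QuantumFields.BalabanUV.T4Continuum.NE7b.PlaquetteCubicTorus

end
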